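import Literature.Probability.LatticeModels.MTP2PairwiseCriterion
import HarnessLib

/-!
# Pairwise TP₂ implies MTP₂ for kernels with line-connected support — definitions

Support files of the Sahi cell (`prim-sahi`, literature seat, generation 45; `--supports stmt-CriticalPhenomena-4575`).
The staged single file `SahiPairwiseTP2LineConnected.lean` (sha256 `2e5be9b26063f148…`, 692 lines) exceeds the 400-line
cap on `Theorems/` files and is landed in three parts with every declaration byte-identical, in the same order within
each part and in the one namespace `Summit.CriticalPhenomena.PercolationContinuityZ3.Theorems.PairwiseTP2LineConnected`
(all announced names unchanged): this file — the four small predicates `LineAdj`, `MonoAdj`, `IsLineConnected`,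
`IsTwoClosed` and the support set `fallatSupport` of [FallatEtAl2017, Example 3.6] with its `DecidablePred` instance;
`Theorems/SahiPairwiseTP2LineConnectedSublattice.lean` — monotone staircases, the join grid, pairwise TP₂ ⟹ MTP₂ for
line-connected SUBLATTICE supports; `Theorems/SahiPairwiseTP2LineConnected.lean` — Example 3.6, two-closedness of
pairwise TP₂ supports and the conjecture of [FallatEtAl2017, §3] in full, with the complete mathematical header.

Definitions only; no sorries, no axioms.
-/

namespace Summit.CriticalPhenomena.PercolationContinuityZ3.Theorems.PairwiseTP2LineConnected

open Function Relation
open Literature.Probability.LatticeModels.FKGEqualityChains (IsLogSupermodular)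
open Literature.Probability.LatticeModels.MTP2PairwiseCriterion (IsPairwiseTP2)

variable {ι : Type*} {α : ι → Type*} [DecidableEq ι] [∀ i, LinearOrder (α i)]

/-! ### Line adjacency, monotone adjacency, line-connected sets -/

omit [DecidableEq ι] [∀ i, LinearOrder (α i)] in
/-- Two configurations are **line-adjacent in `S`**: both lie in `S` and they agree off one coordinate (they lie on a
common axis-parallel line). [this work] -/
def LineAdj (S : Set (∀ i, α i)) (a b : ∀ i, α i) : Prop :=
  a ∈ S ∧ b ∈ S ∧ ∃ i, ∀ j, j ≠ i → a j = b j

omit [DecidableEq ι] in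
/-- **Monotone line adjacency in `S`**: line-adjacent and `a ≤ b` (one coordinate is raised). [this work] -/
def MonoAdj (S : Set (∀ i, α i)) (a b : ∀ i, α i) : Prop :=
  a ∈ S ∧ b ∈ S ∧ a ≤ b ∧ ∃ i, ∀ j, j ≠ i → a j = b j

omit [DecidableEq ι] [∀ i, LinearOrder (α i)] in
/-- **Line-connected** ("coordinate-wise connected") sets: any two points of `S` are joined by a chain of points of `S`,
consecutive ones line-adjacent. [this work] -/
def IsLineConnected (S : Set (∀ i, α i)) : Prop :=
  ∀ x ∈ S, ∀ y ∈ S, ReflTransGen (LineAdj S) x y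

/-! ### The support of [FallatEtAl2017, Example 3.6] -/

/-- The support of [FallatEtAl2017, Example 3.6]: all of `{0,1}³` except `100` and `101` (as `Fin 3 → Bool`).
[cite: FallatEtAl2017, Example 3.6] -/
def fallatSupport : Set (Fin 3 → Bool) :=
  {z | z ≠ ![true, false, false] ∧ z ≠ ![true, false, true]}

/-- Membership in `fallatSupport` is decidable (two point inequalities in `Fin 3 → Bool`); used by the `decide` proofs of
Example 3.6.  (Docstring added at landing: the gate requires one on every declaration; the instance itself is verbatim.) -/
instance : DecidablePred (· ∈ fallatSupport) := fun z =>
  inferInstanceAs (Decidable (z ≠ ![true, false, false] ∧ z ≠ ![true, false, true]))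

/-! ### Two-closed sets -/

omit [DecidableEq ι] in
/-- `S` is **two-closed**: for points of `S` agreeing off two coordinates, meet and join lie in `S` (every
two-dimensional axis-parallel section of `S` is a sublattice; pairs agreeing off ONE coordinate are comparable, so the
case `i = j` is automatic, cf. `isTwoClosed_of`). [this work] -/
def IsTwoClosed (S : Set (∀ i, α i)) : Prop :=
  ∀ a ∈ S, ∀ b ∈ S, ∀ i j : ι, (∀ k, k ≠ i → k ≠ j → a k = b k) → a ⊓ b ∈ S ∧ a ⊔ b ∈ S

end Summit.CriticalPhenomena.PercolationContinuityZ3.Theorems.PairwiseTP2LineConnected
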